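/-
Copyright (c) 2026. All rights reserved.
Released under Apache 2.0 license as described in the file LICENSE.
Authors: HodgeCM publication cell (pub-hodgecm), GR lane, seat GR-2 (`pub-hodgecm-own-hyp34`).
-/
import Literature.NumberTheory.Weil1964.ArchUnitaryWeilHalfGen
import Literature.NumberTheory.Weil1964.ArchLeviSectionQuotient
import Literature.NumberTheory.Weil1964.ArchUnitaryWeilHalfQuotient
import HarnessLib

/-!
# Folland's quotient character of the general archimedean section: `quot (archWeilSectionGen x g) = ∏_{v real} (det g_{w(v)})⁻¹`

Topic `NumberTheory/Weil1964`; namespace `Literature.NumberTheory.Weil1964` (continues `ArchUnitaryWeilHalfGen`,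
`ArchUnitaryWeilHalfQuotient`, `ArchLeviSectionQuotient`).  KERNEL ONLY: theorems; no `def … : Prop` record, no axiom,
no proof hole.

For the section `archWeilSectionGen x = archWeilSectionS ⊠ cxPlacesSection x` of `U(J)(F ⊗ ℝ)` over an arbitrary
number field `F` (`ArchUnitaryWeilHalfGen`), Folland's quotient character is the product over the REAL places of `F`
of the inverse determinants of the components `g_{w(v)} ∈ U(σ_{w(v)} J)(ℂ)` — exactly the totally-real value
(`quot_archWeilSectionS`): `quot` is multiplicative on `⊠` (`MpS.quot_tensor`) and trivial on the conjugated Levi block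
of the complex places (`quot_cxPlacesSection`).  This is the `quot` entering the twist condition
`η(g)² · quot(s(g)) = χ(det_Δ(g,1))²` of `GRConstructionGen.isArchHalf_twist_archLift`: the complex places impose
`η_v² = (χ-factor)²` with no `det^{1/2}` correction.  [Folland1989, §4.2 Thm. (4.37)]; [Paul1998, §1.2 (1.2.2)];
[Kudla1994, §3]; [Adams2007, §5 Rem. 5.6].

## References
* [Folland1989] G. B. Folland, *Harmonic Analysis in Phase Space*, Princeton UP 1989, §4.2 Thm. (4.37).
* [Paul1998] A. Paul, J. Funct. Anal. 159 (1998), §1.2 (1.2.2).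
* [Kudla1994] S. S. Kudla, Israel J. Math. 87 (1994), §3.
-/

set_option autoImplicit false

noncomputable section

open scoped Matrix Real Classical ComplexConjugate
open Complex NumberField NumberField.InfinitePlace NumberField.mixedEmbedding IsDedekindDomain
open Literature.NumberTheory.Automorphic Literature.NumberTheory.Automorphic.UnitaryGroup
open Literature.RepresentationTheory.HeisenbergGroup Literature.Analysis.SegalBargmann
open Literature.RepresentationTheory.KonnoKonno2007 Literature.RepresentationTheory.KonnoKonno2007.RealDualPair

namespace Literature.NumberTheory.Weil1964

open MpS UnitaryWeil

variable {F : Type} [Field F] [NumberField F] (E : Type) [Field E] [NumberField E] [Algebra F E]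
  (c : E ≃ₐ[F] E) (N : ℕ) (hc : c ≠ 1) (hcc : c * c = 1)
  (wOfR : {v : InfinitePlace F // v.IsReal} → {w : InfinitePlace E // w.IsComplex})
  (hwR : ∀ v, c • (wOfR v).1 = (wOfR v).1) (hoverR : ∀ v, (wOfR v).1.comap (algebraMap F E) = v.1)
  (wOf : {v : InfinitePlace F // v.IsComplex} → {w : InfinitePlace E // w.IsComplex})
  (t₀ : Fin N → F) (ht0 : ∀ j, t₀ j ≠ 0) {T : Matrix (Fin N) (Fin N) F} (hTd : T = Matrix.diagonal t₀)
  {J : Matrix (Fin N) (Fin N) E} (hJ : J = T.map (algebraMap F E)) {δ : E} (hcδ : c δ = -δ) (hδ : δ ≠ 0)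

/-- **THE QUOTIENT CHARACTER OF THE GENERAL ARCHIMEDEAN SECTION**:
`quot (archWeilSectionGen x g) = ∏_{v real} (det g_{w(v)})⁻¹` — the complex places of `F` contribute nothing.
[cite: Folland1989, §4.2 Thm. (4.37); Paul1998, §1.2 (1.2.2); Kudla1994, §3] -/
theorem quot_archWeilSectionGen (x : MpS ((Fin N ⊕ Fin N) × {v : InfinitePlace F // v.IsComplex}))
    (g : UnitaryGroup.arch F E c N J) :
    MpS.quot (archWeilSectionGen E c N hc hcc wOfR hwR hoverR wOf t₀ ht0 hTd hJ hcδ hδ x g) =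
      ∏ v : {v : InfinitePlace F // v.IsReal},
        ((((archAt F E c N J (wOfR v) (hwR v) hc g : archLocal E N J (wOfR v)) : GL (Fin N) ℂ) :
          Matrix (Fin N) (Fin N) ℂ).det)⁻¹ := by
  rw [archWeilSectionGen_apply, MpS.quot_tensor, quot_cxPlacesSection, mul_one, quot_archWeilSectionS]

/-- hence the twist condition of `GRConstructionGen.isArchHalf_twist_archLift` for `archWeilSectionGen` reads
`η(g)² · ∏_{v real} (det g_{w(v)})⁻¹ = (…)²` — independent of the lift `x` and of the complex places.
[cite: Folland1989, §4.2 Thm. (4.37)] -/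
theorem sq_mul_quot_archWeilSectionGen_eq_iff (x : MpS ((Fin N ⊕ Fin N) × {v : InfinitePlace F // v.IsComplex}))
    (g : UnitaryGroup.arch F E c N J) (a b : ℂ) :
    a ^ 2 * MpS.quot (archWeilSectionGen E c N hc hcc wOfR hwR hoverR wOf t₀ ht0 hTd hJ hcδ hδ x g) = b ↔
      a ^ 2 * ∏ v : {v : InfinitePlace F // v.IsReal},
        ((((archAt F E c N J (wOfR v) (hwR v) hc g : archLocal E N J (wOfR v)) : GL (Fin N) ℂ) :
          Matrix (Fin N) (Fin N) ℂ).det)⁻¹ = b := by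
  rw [quot_archWeilSectionGen]

end Literature.NumberTheory.Weil1964

end
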